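import Literature.AnabelianGeometry.EtaleTheta.Discharge.Sec5Thm57FinalKnitV2
import Literature.AnabelianGeometry.EtaleTheta.Discharge.Sec5DivTransportAssemblyGenuine
import Literature.AnabelianGeometry.EtaleTheta.Discharge.Sec5ThetaDivisorRootPairDescent
import Literature.AnabelianGeometry.EtaleTheta.Discharge.Sec4Prop42SubRootPair

/-!
# [EtTh] §5, Theorem 5.7 at the genuine connected tower — the LINKS FOLD: the anchor binder `hdivA` of the closers from G-w5d245-2's links (p. 326, 329 / PDF pp. 100, 103)

Mochizuki, *The étale theta function and its Frobenioid-theoretic manifestations*, Publ. RIMS **45** (2009)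
[cite: MochizukiEtTh2009, Thm 5.6 proof p.329 (PDF p.103); Prop 5.3 (vi) p.326 (PDF p.100); Prop 5.2 (i) p.324 (PDF p.98); Thm 5.7
p.329–330 (PDF pp.103–104)].  Print (proof of Thm. 5.6, p.329): «since `Ψ` [essentially] preserves the divisor of zeroes and poles of
`Θ̈` [cf. Proposition 5.3, (vi)], it follows … that there exist isomorphisms `γ₁ : S₁ ⥲ T₁`, `γ₂ : S₂ ⥲ T₂` …».
Seat abc-iut-L2-d4 (gen 5; node `EtTh:Thm5.7`, abc-iut-L2-lead R493 «links fold (L2-d4)»).  PROOF-ONLY (0 definitions; nothing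
landed is edited or restated).

THE POINT.  Every Thm. 5.7 closer at the genuine connected tower (`…_final_v2` p448709, abc-iut-w6-d077's `…_final_v3`,
abc-iut-w5-d123's Setting twins) carries the ANCHOR binder
  `hdivA : ∀ αA : Ψ(A_1) ≅ A_1, ∃ ε ∈ Aut_C(A_1), Div(αA⁻¹ ≫ Ψ s^⊓_1) = Div(ε ≫ s^⊓_1) ∧ Div(αA⁻¹ ≫ Ψ s^⊔_1) = Div(ε ≫ s^⊔_1)`
(«`Ψ` essentially preserves the divisor of the theta root pair at `A_1`»), stated over the tower `T = ofConnectedTemperoidFamily …`.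
abc-iut-w5-d245's G-w5d245-2 assembly `exists_aut_div_transport_eq_of_links_ofConnectedTemperoidData` (p448041) produces exactly this
shape at the level-1 data from the four links {`induced` (LINK (a): Thm. 4.9 at `A_⊚`), `hsplit` (LINK (c): the zero/pole split of
Prop. 5.3 (vi)+(i)), `hdesc` (LINK (b)), `htf`/`hof` (cancellation in `Φ(A_1)`)}; abc-iut-w6-d043's
`rootPair_hdesc_ofConnectedTemperoidData` (p450637) DISCHARGES LINK (b) at the genuine data with `n := 1·l`, `φ := α_1 ≫ α_l`,
`Z₀ := [Div Pl.num]`, `W₀ := [Div Pl.den]` (the two stacked root squares of Prop. 5.2 (i)); `htf`/`hof` are [FrdI] §0 facts for the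
divisorial monoid `Φ(A_1)` (`BiKummerSetting.gp_pow_injective_of_isDivisorial`, `IsIntegral.injective_of`).
`ThetaFrobenioidTower.hdivA_ofConnectedTemperoidFamily_of_links` : the binder `hdivA` VERBATIM (tower currency, `T` with its defining
equation `hT` as in the closers) ⟸ {`ι`, `eΦ`, `induced`, `hsplit`} — so every closer's `hdivA` is replaced by LINK (a) + LINK (c) by
passing this term; no closer is re-filed.
HONEST FRAMING: kernel-checked composition; `induced` (Thm. 4.9 at `A_⊚`) and `hsplit` (Prop. 5.3 (vi)+(i) split, whose honest inputs
are abc-iut-L6-d1's repaired support data) remain named hypotheses; nothing asserts that such data exist for an actual curve; typed ≠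
discharged; no side taken on anything downstream ([IUTchIII] Cor. 3.12 in particular). -/

noncomputable section

namespace Literature.AnabelianGeometry.EtaleTheta

open CategoryTheory Opposite Literature.AlgebraicGeometry.Frobenioids Literature.AnabelianGeometry.SemiGraphs
  Literature.AnabelianGeometry.SemiGraphs.GaloisObjects

universe v₀

namespace ThetaFrobenioidTower

section LinksFold

variable {K : Type} [Field K] {X : SemiGraphs.TemperedArithmeticGroup.{0} K} {D₀ : Type} [Category.{v₀} D₀]
  {V : FrdIMonoidStub.{0}} {T₀ : RealifiedDivisorMonoids (D₀ := D₀) V}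
  {VD : FrdICatStub.{1, 0, 0} (ConnectedPart (BTemp X.Pi))}
  {tf : TemperedFrobenioid T₀ (ConnectedPart (BTemp X.Pi)) VD} {hZ : tf.monoidType = MonoidType.Z}
  {hP : ∀ A : (ConnectedPart (BTemp X.Pi))ᵒᵖ, IsPerfect (tf.Φ.carrier A)}
  {NH : Subgroup (Field.absoluteGaloisGroup K) → tf.category → ℕ+ → Prop}
  {E : Set ℕ+} (𝒯 : ThetaEnvTower.{0} E) (ιX : 𝒯.PiX ≃ₜ* X.Pi)
  {pullFrac : ∀ {A A' : (BiKummerSetting.mkOfConnectedTemperoidYddTower X tf hZ hP NH 𝒯 ιX).C} (_ : A' ⟶ A),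
    (BiKummerSetting.mkOfConnectedTemperoidYddTower X tf hZ hP NH 𝒯 ιX).biratUnits A →
      (BiKummerSetting.mkOfConnectedTemperoidYddTower X tf hZ hP NH 𝒯 ιX).biratUnits A'}
  {lv : ℕ+}
  {θ : (BiKummerSetting.mkOfConnectedTemperoidYddTower X tf hZ hP NH 𝒯 ιX).biratUnits
    (BiKummerSetting.mkOfConnectedTemperoidYddTower X tf hZ hP NH 𝒯 ιX).Aodot}
  {Bl : (BiKummerSetting.mkOfConnectedTemperoidYddTower X tf hZ hP NH 𝒯 ιX).C}
  {Pl : (BiKummerSetting.mkOfConnectedTemperoidYddTower X tf hZ hP NH 𝒯 ιX).FractionPair θ Bl}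
  {Rl : (BiKummerSetting.mkOfConnectedTemperoidYddTower X tf hZ hP NH 𝒯 ιX).NthRoot θ Pl lv pullFrac}
  (h : ModelFrobenioid.Hypotheses tf.divisorMonoid tf.ratFnFunctor)
  (Q : FrobenioidTheta.ThetaSubquotientStub.{0} (ConnectedPart (BTemp X.Pi))) (odd_l : Odd (lv : ℕ))
  (R : ∀ N : ℕ+, (BiKummerSetting.mkOfConnectedTemperoidYddTower X tf hZ hP NH 𝒯 ιX).NthRoot Rl.root Rl.pair N pullFrac)
  (K' : Type) [Field K'] {X₀ : ConnectedPart (BTemp X.Pi)} (t : ∀ N : ℕ+, (R N).BN.base ⟶ X₀)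
  (c₀ : K'ˣ →* (tf.ratFnFunctor.obj (op X₀))ˣ)
  (hc₀ : Function.Injective c₀) (ht : ∀ N : ℕ+, Function.Injective (tf.ratFnFunctor.map (t N).op).hom)
  (hinvc : ∀ (N : ℕ+) (g : Aut (R N).AN.base),
    pull tf.divisorMonoid g.hom (ModelFrobenioid.div (R N).pair.num) = ModelFrobenioid.div (R N).pair.num)
  (hinvp : ∀ (N : ℕ+) (y : 𝒯.PiX), y ∈ 𝒯.PiYdd →
    pull tf.divisorMonoid ((BiKummerSetting.mkOfConnectedTemperoidYddTower X tf hZ hP NH 𝒯 ιX).galoisSurj (R N).AN.base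
      (R N).αData.isGalois (ιX y)).hom (ModelFrobenioid.div (R N).pair.den) = ModelFrobenioid.div (R N).pair.den)
  (α : ∀ {N N' : ℕ+}, (N : ℕ) ∣ N' → ((R N').AN ⟶ (R N).AN))
  (β : ∀ {N N' : ℕ+}, (N : ℕ) ∣ N' → ((R N').BN ⟶ (R N).BN))
  (comm_sCap : ∀ {N N' : ℕ+} (hd : (N : ℕ) ∣ N'), (R N').pair.num ≫ β hd = α hd ≫ (R N).pair.num)
  (comm_sCup : ∀ {N N' : ℕ+} (hd : (N : ℕ) ∣ N'), (R N').pair.den ≫ β hd = α hd ≫ (R N).pair.den)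
  (isIsometry_α : ∀ {N N' : ℕ+} (hd : (N : ℕ) ∣ N'),
    ((BiKummerSetting.mkOfConnectedTemperoidYddTower X tf hZ hP NH 𝒯 ιX).sec5Stub h).pre.IsIsometry (α hd))
  (degFr_α : ∀ {N N' : ℕ+} (hd : (N : ℕ) ∣ N'),
    (((BiKummerSetting.mkOfConnectedTemperoidYddTower X tf hZ hP NH 𝒯 ιX).sec5Stub h).pre.degFr (α hd) : ℕ) * N = N')
  (isIsometry_β : ∀ {N N' : ℕ+} (hd : (N : ℕ) ∣ N'),
    ((BiKummerSetting.mkOfConnectedTemperoidYddTower X tf hZ hP NH 𝒯 ιX).sec5Stub h).pre.IsIsometry (β hd))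
  (degFr_β : ∀ {N N' : ℕ+} (hd : (N : ℕ) ∣ N'),
    (((BiKummerSetting.mkOfConnectedTemperoidYddTower X tf hZ hP NH 𝒯 ιX).sec5Stub h).pre.degFr (β hd) : ℕ) * N = N')
  (baseFrob_α : ∀ {N N' : ℕ+} (hd : (N : ℕ) ∣ N'),
    (BiKummerSetting.mkOfConnectedTemperoidYddTower X tf hZ hP NH 𝒯 ιX).IsOfBaseFrobeniusType (α hd))
  -- the self-equivalence and LINK (a)'s data at `A_⊚` for the level-1 §5 data
  (Ψ : (BiKummerSetting.mkOfConnectedTemperoidYddTower X tf hZ hP NH 𝒯 ιX).C ≌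
    (BiKummerSetting.mkOfConnectedTemperoidYddTower X tf hZ hP NH 𝒯 ιX).C)
  (ι : Ψ.functor.obj
      (ThetaFrobenioid.ofConnectedTemperoidData (T := 𝒯.level ⟨1, 𝒯.one_mem⟩) h Q odd_l (R 1) ιX K'
        ((Units.map (tf.ratFnFunctor.map (t 1).op).hom).comp c₀) (tf.unitsMap_comp_injective (t 1) hc₀ (ht 1)) (hinvc 1)
        (hinvp 1)).Acirc ≅
    (ThetaFrobenioid.ofConnectedTemperoidData (T := 𝒯.level ⟨1, 𝒯.one_mem⟩) h Q odd_l (R 1) ιX K'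
        ((Units.map (tf.ratFnFunctor.map (t 1).op).hom).comp c₀) (tf.unitsMap_comp_injective (t 1) hc₀ (ht 1)) (hinvc 1)
        (hinvp 1)).Acirc)
  {eΦ : (ThetaFrobenioid.ofConnectedTemperoidData (T := 𝒯.level ⟨1, 𝒯.one_mem⟩) h Q odd_l (R 1) ιX K'
        ((Units.map (tf.ratFnFunctor.map (t 1).op).hom).comp c₀) (tf.unitsMap_comp_injective (t 1) hc₀ (ht 1)) (hinvc 1)
        (hinvp 1)).PhiAcirc ≃*
    (ThetaFrobenioid.ofConnectedTemperoidData (T := 𝒯.level ⟨1, 𝒯.one_mem⟩) h Q odd_l (R 1) ιX K'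
        ((Units.map (tf.ratFnFunctor.map (t 1).op).hom).comp c₀) (tf.unitsMap_comp_injective (t 1) hc₀ (ht 1)) (hinvc 1)
        (hinvp 1)).pre.Mon
      ((ThetaFrobenioid.ofConnectedTemperoidData (T := 𝒯.level ⟨1, 𝒯.one_mem⟩) h Q odd_l (R 1) ιX K'
          ((Units.map (tf.ratFnFunctor.map (t 1).op).hom).comp c₀) (tf.unitsMap_comp_injective (t 1) hc₀ (ht 1)) (hinvc 1)
          (hinvp 1)).base.obj
        (Ψ.functor.obj
          (ThetaFrobenioid.ofConnectedTemperoidData (T := 𝒯.level ⟨1, 𝒯.one_mem⟩) h Q odd_l (R 1) ιX K'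
            ((Units.map (tf.ratFnFunctor.map (t 1).op).hom).comp c₀) (tf.unitsMap_comp_injective (t 1) hc₀ (ht 1)) (hinvc 1)
            (hinvp 1)).Acirc))}
  (induced : (FrobenioidThetaDivisors.DivisorTransportStub.ofThm49
      (ThetaFrobenioid.ofConnectedTemperoidData (T := 𝒯.level ⟨1, 𝒯.one_mem⟩) h Q odd_l (R 1) ιX K'
        ((Units.map (tf.ratFnFunctor.map (t 1).op).hom).comp c₀) (tf.unitsMap_comp_injective (t 1) hc₀ (ht 1)) (hinvc 1)
        (hinvp 1))).IsInducedBy Ψ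
    (ThetaFrobenioid.ofConnectedTemperoidData (T := 𝒯.level ⟨1, 𝒯.one_mem⟩) h Q odd_l (R 1) ιX K'
        ((Units.map (tf.ratFnFunctor.map (t 1).op).hom).comp c₀) (tf.unitsMap_comp_injective (t 1) hc₀ (ht 1)) (hinvc 1)
        (hinvp 1)).Acirc eΦ)
  -- LINK (c): the zero/pole SPLIT of Prop. 5.3 (vi)+(i) for the divisors of the `l`-th root pair `Pl`
  (hsplit : ∃ g : Aut (ThetaFrobenioid.ofConnectedTemperoidData (T := 𝒯.level ⟨1, 𝒯.one_mem⟩) h Q odd_l (R 1) ιX K'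
        ((Units.map (tf.ratFnFunctor.map (t 1).op).hom).comp c₀) (tf.unitsMap_comp_injective (t 1) hc₀ (ht 1)) (hinvc 1)
        (hinvp 1)).Acirc,
    ThetaFrobenioid.gpMap
        (FrobenioidThetaDivisors.psiPhi
            (ThetaFrobenioid.ofConnectedTemperoidData (T := 𝒯.level ⟨1, 𝒯.one_mem⟩) h Q odd_l (R 1) ιX K'
              ((Units.map (tf.ratFnFunctor.map (t 1).op).hom).comp c₀) (tf.unitsMap_comp_injective (t 1) hc₀ (ht 1)) (hinvc 1)
              (hinvp 1)) Ψ ι eΦ :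
          (ThetaFrobenioid.ofConnectedTemperoidData (T := 𝒯.level ⟨1, 𝒯.one_mem⟩) h Q odd_l (R 1) ιX K'
              ((Units.map (tf.ratFnFunctor.map (t 1).op).hom).comp c₀) (tf.unitsMap_comp_injective (t 1) hc₀ (ht 1)) (hinvc 1)
              (hinvp 1)).PhiAcirc →*
            (ThetaFrobenioid.ofConnectedTemperoidData (T := 𝒯.level ⟨1, 𝒯.one_mem⟩) h Q odd_l (R 1) ιX K'
              ((Units.map (tf.ratFnFunctor.map (t 1).op).hom).comp c₀) (tf.unitsMap_comp_injective (t 1) hc₀ (ht 1)) (hinvc 1)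
              (hinvp 1)).PhiAcirc)
        (Algebra.GrothendieckGroup.of
          ((ThetaFrobenioid.ofConnectedTemperoidData (T := 𝒯.level ⟨1, 𝒯.one_mem⟩) h Q odd_l (R 1) ιX K'
              ((Units.map (tf.ratFnFunctor.map (t 1).op).hom).comp c₀) (tf.unitsMap_comp_injective (t 1) hc₀ (ht 1)) (hinvc 1)
              (hinvp 1)).pre.div Pl.num)) =
      ThetaFrobenioid.gpMap
        ((ThetaFrobenioid.ofConnectedTemperoidData (T := 𝒯.level ⟨1, 𝒯.one_mem⟩) h Q odd_l (R 1) ιX K'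
              ((Units.map (tf.ratFnFunctor.map (t 1).op).hom).comp c₀) (tf.unitsMap_comp_injective (t 1) hc₀ (ht 1)) (hinvc 1)
              (hinvp 1)).pullAut g :
          (ThetaFrobenioid.ofConnectedTemperoidData (T := 𝒯.level ⟨1, 𝒯.one_mem⟩) h Q odd_l (R 1) ιX K'
              ((Units.map (tf.ratFnFunctor.map (t 1).op).hom).comp c₀) (tf.unitsMap_comp_injective (t 1) hc₀ (ht 1)) (hinvc 1)
              (hinvp 1)).PhiAcirc →*
            (ThetaFrobenioid.ofConnectedTemperoidData (T := 𝒯.level ⟨1, 𝒯.one_mem⟩) h Q odd_l (R 1) ιX K'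
              ((Units.map (tf.ratFnFunctor.map (t 1).op).hom).comp c₀) (tf.unitsMap_comp_injective (t 1) hc₀ (ht 1)) (hinvc 1)
              (hinvp 1)).PhiAcirc)
        (Algebra.GrothendieckGroup.of
          ((ThetaFrobenioid.ofConnectedTemperoidData (T := 𝒯.level ⟨1, 𝒯.one_mem⟩) h Q odd_l (R 1) ιX K'
              ((Units.map (tf.ratFnFunctor.map (t 1).op).hom).comp c₀) (tf.unitsMap_comp_injective (t 1) hc₀ (ht 1)) (hinvc 1)
              (hinvp 1)).pre.div Pl.num)) ∧
    ThetaFrobenioid.gpMap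
        (FrobenioidThetaDivisors.psiPhi
            (ThetaFrobenioid.ofConnectedTemperoidData (T := 𝒯.level ⟨1, 𝒯.one_mem⟩) h Q odd_l (R 1) ιX K'
              ((Units.map (tf.ratFnFunctor.map (t 1).op).hom).comp c₀) (tf.unitsMap_comp_injective (t 1) hc₀ (ht 1)) (hinvc 1)
              (hinvp 1)) Ψ ι eΦ :
          (ThetaFrobenioid.ofConnectedTemperoidData (T := 𝒯.level ⟨1, 𝒯.one_mem⟩) h Q odd_l (R 1) ιX K'
              ((Units.map (tf.ratFnFunctor.map (t 1).op).hom).comp c₀) (tf.unitsMap_comp_injective (t 1) hc₀ (ht 1)) (hinvc 1)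
              (hinvp 1)).PhiAcirc →*
            (ThetaFrobenioid.ofConnectedTemperoidData (T := 𝒯.level ⟨1, 𝒯.one_mem⟩) h Q odd_l (R 1) ιX K'
              ((Units.map (tf.ratFnFunctor.map (t 1).op).hom).comp c₀) (tf.unitsMap_comp_injective (t 1) hc₀ (ht 1)) (hinvc 1)
              (hinvp 1)).PhiAcirc)
        (Algebra.GrothendieckGroup.of
          ((ThetaFrobenioid.ofConnectedTemperoidData (T := 𝒯.level ⟨1, 𝒯.one_mem⟩) h Q odd_l (R 1) ιX K'
              ((Units.map (tf.ratFnFunctor.map (t 1).op).hom).comp c₀) (tf.unitsMap_comp_injective (t 1) hc₀ (ht 1)) (hinvc 1)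
              (hinvp 1)).pre.div Pl.den)) =
      ThetaFrobenioid.gpMap
        ((ThetaFrobenioid.ofConnectedTemperoidData (T := 𝒯.level ⟨1, 𝒯.one_mem⟩) h Q odd_l (R 1) ιX K'
              ((Units.map (tf.ratFnFunctor.map (t 1).op).hom).comp c₀) (tf.unitsMap_comp_injective (t 1) hc₀ (ht 1)) (hinvc 1)
              (hinvp 1)).pullAut g :
          (ThetaFrobenioid.ofConnectedTemperoidData (T := 𝒯.level ⟨1, 𝒯.one_mem⟩) h Q odd_l (R 1) ιX K'
              ((Units.map (tf.ratFnFunctor.map (t 1).op).hom).comp c₀) (tf.unitsMap_comp_injective (t 1) hc₀ (ht 1)) (hinvc 1)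
              (hinvp 1)).PhiAcirc →*
            (ThetaFrobenioid.ofConnectedTemperoidData (T := 𝒯.level ⟨1, 𝒯.one_mem⟩) h Q odd_l (R 1) ιX K'
              ((Units.map (tf.ratFnFunctor.map (t 1).op).hom).comp c₀) (tf.unitsMap_comp_injective (t 1) hc₀ (ht 1)) (hinvc 1)
              (hinvp 1)).PhiAcirc)
        (Algebra.GrothendieckGroup.of
          ((ThetaFrobenioid.ofConnectedTemperoidData (T := 𝒯.level ⟨1, 𝒯.one_mem⟩) h Q odd_l (R 1) ιX K'
              ((Units.map (tf.ratFnFunctor.map (t 1).op).hom).comp c₀) (tf.unitsMap_comp_injective (t 1) hc₀ (ht 1)) (hinvc 1)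
              (hinvp 1)).pre.div Pl.den)))

include induced hsplit in
/-- **The anchor binder `hdivA` of the Thm. 5.7 closers FROM the links** (G-w5d245-2 assembly p448041 ∘ LINK (b) p450637; `htf`,
`hof` by [FrdI] §0 for the divisorial `Φ(A_1)`): for every anchor `αA : Ψ(A_1) ≅ A_1` there is `ε ∈ Aut_C(A_1)` with
`Div(αA⁻¹ ≫ Ψ s^⊓_1) = Div(ε ≫ s^⊓_1)` and `Div(αA⁻¹ ≫ Ψ s^⊔_1) = Div(ε ≫ s^⊔_1)` — VERBATIM the binder `hdivA` of
`thetaRootPreservedAll_ofConnectedTemperoidYddFamily_final_v2` (tower currency, `T` bound by `hT`), modulo LINK (a) (`induced`) and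
LINK (c) (`hsplit`) only.  [cite: MochizukiEtTh2009, Thm 5.6 proof p.329 (PDF p.103); Prop 5.3 (vi) p.326 (PDF p.100); Prop 5.2 (i) p.324 (PDF p.98)] -/
theorem hdivA_ofConnectedTemperoidFamily_of_links
    (T : ThetaFrobenioidTower.{0} (BiKummerSetting.mkOfConnectedTemperoidYddTower X tf hZ hP NH 𝒯 ιX).C
      (ConnectedPart (BTemp X.Pi)))
    (hT : T = ofConnectedTemperoidFamily h Q odd_l R ιX K' (fun N => (Units.map (tf.ratFnFunctor.map (t N).op).hom).comp c₀)
      (fun N => tf.unitsMap_comp_injective (t N) hc₀ (ht N)) hinvc hinvp α β comm_sCap comm_sCup isIsometry_α degFr_α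
      isIsometry_β degFr_β baseFrob_α) :
    ∀ αA : Ψ.functor.obj (T.AN 1) ≅ T.AN 1, ∃ ε : Aut (T.AN 1),
      T.pre.div (αA.inv ≫ Ψ.functor.map (T.sCap 1)) = T.pre.div (ε.hom ≫ T.sCap 1) ∧
      T.pre.div (αA.inv ≫ Ψ.functor.map (T.sCup 1)) = T.pre.div (ε.hom ≫ T.sCup 1) := by
  subst hT
  intro αA
  exact ThetaFrobenioid.exists_aut_div_transport_eq_of_links_ofConnectedTemperoidData (T := 𝒯.level ⟨1, 𝒯.one_mem⟩) h Q odd_l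
    (R 1) ιX K' ((Units.map (tf.ratFnFunctor.map (t 1).op).hom).comp c₀) (tf.unitsMap_comp_injective (t 1) hc₀ (ht 1)) (hinvc 1)
    (hinvp 1) Ψ ι ((R 1).α ≫ Rl.α) induced _ _ hsplit
    (ThetaFrobenioid.rootPair_hdesc_ofConnectedTemperoidData (T := 𝒯.level ⟨1, 𝒯.one_mem⟩) h Q odd_l (R 1) ιX K'
      ((Units.map (tf.ratFnFunctor.map (t 1).op).hom).comp c₀) (tf.unitsMap_comp_injective (t 1) hc₀ (ht 1)) (hinvc 1) (hinvp 1))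
    (fun x y hxy => BiKummerSetting.gp_pow_injective_of_isDivisorial (h.isDivisorial (R 1).AN.base) (1 * lv) hxy)
    (h.isDivisorial (R 1).AN.base).isPreDivisorial.isIntegral.injective_of αA

end LinksFold

end ThetaFrobenioidTower

end Literature.AnabelianGeometry.EtaleTheta

end
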